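import Mathlib
import Summits.Schanuel.Schanuel.Theses.ExceptionalSubspaces
import Summits.Schanuel.Schanuel.Theorems.RigidCoreSchanuelOnLogFreeCoreSectorGlue
import Literature.NumberTheory.Transcendental.LindemannWeierstrassProofs

/-!
# Line `sector-split` (route `RigidCore`), skeleton v6: exceptional subspaces are closed under intersection

Prover file for the registered stub `stub_exceptionalSubspacesIntersect` of line `sector-split`
(v6, axes refinement) of crux `stmt-Schanuel-0970`
(`Summit.Schanuel.Schanuel.Theses.RigidCore.SchanuelOnLogFreeCore`, "(R)": Schanuel's statement for
`ℚ`-linearly independent tuples from the log-free core `C_EA`).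

The line splits (R) ⟺ residue 1 ∧ residue 2, residue 1 = `PiFreeOverLWField` (item
stmt-Schanuel-9545: `π` is transcendental over the Lindemann–Weierstrass field `ℚ(e^α : α ∈ ℚ̄)`).
Skeleton v6 refines residue 1 along complex conjugation; its ENGINE is the theorem proved here,
which is VERBATIM the support item stmt-Schanuel-9553
`Summit.Schanuel.Schanuel.Theses.ExceptionalSubspaces.ExceptionalSubspacesIntersect` of the sibling
route ExceptionalSubspaces (the "exceptional-subspace formalism"):

  for `ℚ`-subspaces `A, B ≤ ℂ` consisting of algebraic numbers and any `η ∈ ℂ`, if `η` is algebraic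
  over `ℚ(e^A)` and over `ℚ(e^B)`, then `η` is algebraic over `ℚ(e^{A ∩ B})`.

So the exceptional subspaces `{A ≤ ℚ̄ : η ∈ ℚ(e^A)^{alg}}` of any `η` are closed under `∩`; in
particular a number algebraic over the LW field has a unique MINIMAL exceptional subspace.

Proof (`SubspaceIntersect.engine`), in Mathlib's algebraic matroid `M` of `ℂ/ℚ`
(`AlgebraicIndependent.matroid`; `M.closure S = {η | η algebraic over ℚ[S]}`):
1. choose a `ℚ`-basis `u` of `A ∩ B` and extend it to bases `bA ⊇ u` of `A` and `bB ⊇ u` of `B`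
   (`exists_linearIndepOn_id_extension`); then `bA ∪ bB` is `ℚ`-linearly independent
   (`span bA ∩ span (bB ∖ bA) ⊆ A ∩ B = span u` and `u ⊔ (bB ∖ bA)` is free inside `bB`);
2. Lindemann–Weierstrass (tree theorem `algebraicIndependent_exp_holds`): `exp '' (bA ∪ bB)` is
   `M`-independent and `exp` is injective on `bA ∪ bB`;
3. `M.closure (exp '' A) = M.closure (exp '' bA)`: every `e^a`, `a ∈ A = span bA`, is algebraic
   over `ℚ(e^{bA})` (products and rational powers: `e^{(m/n)b}` is an `n`-th root of `(e^b)^m`);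
4. flats of independent sets intersect well (`Matroid.Indep.closure_inter_eq_inter_closure`):
   `M.closure (exp '' bA) ∩ M.closure (exp '' bB) = M.closure (exp '' (bA ∩ bB))
   ⊆ M.closure (exp '' (A ∩ B))`.
Everything is Mathlib plus Lindemann–Weierstrass; no new definitions; works for subspaces of any
dimension (no finiteness hypothesis).

References: A. Baker, *Transcendental Number Theory* (1975), Ch. 1 Thm 1.4 (Lindemann–Weierstrass);
S. Lang, *Introduction to Transcendental Numbers* (1966), Ch. I (exchange / transcendence bases).
-/

noncomputable section

namespace Summit.Schanuel.Schanuel.Theorems.RigidCore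

open Summit.Schanuel.Schanuel.Theses
open Literature.NumberTheory.Transcendental (algebraicIndependent_exp_holds)
open Complex (exp)
open Set Submodule

namespace SubspaceIntersect

/-! ## Dictionary: algebraicity over `ℚ(S)` = membership in the matroid closure of `S` -/

/-- `η` is algebraic over the field `ℚ(S)` iff `η` lies in the closure of `S` in the algebraic
matroid of `ℂ/ℚ`. [folklore] -/
theorem isAlgebraic_adjoin_iff_mem_closure (S : Set ℂ) (η : ℂ) :
    IsAlgebraic ↥(IntermediateField.adjoin ℚ S) η ↔
      η ∈ (AlgebraicIndependent.matroid ℚ ℂ).closure S := by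
  rw [IntermediateField.isAlgebraic_adjoin_iff, AlgebraicIndependent.matroid_closure_eq]
  rfl

/-! ## Lindemann–Weierstrass in matroid form -/

/-- Lindemann–Weierstrass, set form: the exponentials of a `ℚ`-linearly independent set of
algebraic numbers form an independent set of the algebraic matroid of `ℂ/ℚ`, and `exp` is
injective on such a set. [cite: BakerTNT1975, Ch. 1 Thm 1.4] -/
theorem indep_exp_image {T : Set ℂ} (halg : ∀ z ∈ T, IsAlgebraic ℚ z)
    (hli : LinearIndepOn ℚ id T) :
    (AlgebraicIndependent.matroid ℚ ℂ).Indep (exp '' T) ∧ Set.InjOn exp T := by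
  have h : AlgebraicIndependent ℚ (fun t : T => exp (t : ℂ)) :=
    algebraicIndependent_exp_holds (fun t : T => (t : ℂ)) (fun t => halg t t.2) hli
  refine ⟨?_, ?_⟩
  · rw [AlgebraicIndependent.matroid_indep_iff, AlgebraicIndepOn, Set.image_eq_range]
    exact h.coe_range
  · exact Set.injOn_iff_injective.2 h.injective

/-! ## Exponentials of a span are algebraic over the exponentials of a spanning set -/

/-- If `A ⊆ span_ℚ T` then every `e^a`, `a ∈ A`, is algebraic over `ℚ(e^T)`: `exp` turns sums
into products and `e^{q t}` (`q ∈ ℚ`) is a radical of a power of `e^t`. [folklore] -/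
theorem exp_mem_closure_of_subset_span {A T : Set ℂ} (hAT : A ⊆ span ℚ T) {a : ℂ} (ha : a ∈ A) :
    exp a ∈ (AlgebraicIndependent.matroid ℚ ℂ).closure (exp '' T) := by
  rw [← isAlgebraic_adjoin_iff_mem_closure]
  set K := IntermediateField.adjoin ℚ (exp '' T) with hK
  suffices h : exp a ∈ algebraicClosure K ℂ from mem_algebraicClosure_iff.1 h
  refine Submodule.span_induction (p := fun x _ => exp x ∈ algebraicClosure K ℂ)
    (fun x hx => ?_) ?_ (fun x y _ _ hx hy => ?_) (fun q x _ hx => ?_) (hAT ha)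
  · have hxK : exp x ∈ K := IntermediateField.subset_adjoin ℚ _ ⟨x, hx, rfl⟩
    exact IntermediateField.algebraMap_mem (algebraicClosure K ℂ) (⟨exp x, hxK⟩ : K)
  · rw [Complex.exp_zero]; exact one_mem _
  · rw [Complex.exp_add]; exact mul_mem hx hy
  · rw [Rat.smul_def]
    exact SectorGlue.exp_rat_mul_mem_algebraicClosure K x q hx

/-- Hence `M.closure (exp '' A) ⊆ M.closure (exp '' T)` whenever `A ⊆ span_ℚ T`. [folklore] -/
theorem closure_exp_image_subset_of_subset_span {A T : Set ℂ} (hAT : A ⊆ span ℚ T) :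
    (AlgebraicIndependent.matroid ℚ ℂ).closure (exp '' A) ⊆
      (AlgebraicIndependent.matroid ℚ ℂ).closure (exp '' T) := by
  refine (AlgebraicIndependent.matroid ℚ ℂ).closure_subset_closure_of_subset_closure ?_
  rintro _ ⟨a, ha, rfl⟩
  exact exp_mem_closure_of_subset_span hAT ha

/-! ## The engine -/

/-- **Exceptional subspaces are closed under intersection.** For `ℚ`-subspaces `A, B ≤ ℂ`
consisting of algebraic numbers and any `η ∈ ℂ`: if `η` is algebraic over `ℚ(e^A)` and over
`ℚ(e^B)`, then `η` is algebraic over `ℚ(e^{A ∩ B})`. (Lindemann–Weierstrass + intersection of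
flats spanned by parts of one independent set of the algebraic matroid.) [folklore] -/
theorem engine (η : ℂ) (A B : Submodule ℚ ℂ) (hAalg : ∀ z ∈ A, IsAlgebraic ℚ z)
    (hBalg : ∀ z ∈ B, IsAlgebraic ℚ z)
    (hA : IsAlgebraic ↥(IntermediateField.adjoin ℚ (exp '' (A : Set ℂ))) η)
    (hB : IsAlgebraic ↥(IntermediateField.adjoin ℚ (exp '' (B : Set ℂ))) η) :
    IsAlgebraic ↥(IntermediateField.adjoin ℚ (exp '' ((A ⊓ B : Submodule ℚ ℂ) : Set ℂ))) η := by
  set M := AlgebraicIndependent.matroid ℚ ℂ with hM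
  rw [isAlgebraic_adjoin_iff_mem_closure] at hA hB ⊢
  -- (1) a basis `u` of `A ⊓ B`, extended to bases `bA` of `A` and `bB` of `B`
  obtain ⟨u, huU, -, hUu, hu⟩ := exists_linearIndepOn_id_extension
    (linearIndepOn_empty ℚ id) (Set.empty_subset ((A ⊓ B : Submodule ℚ ℂ) : Set ℂ))
  have huA : u ⊆ (A : Set ℂ) := huU.trans fun z hz => (Submodule.mem_inf.1 hz).1
  have huB : u ⊆ (B : Set ℂ) := huU.trans fun z hz => (Submodule.mem_inf.1 hz).2
  obtain ⟨bA, hbAA, hubA, hAbA, hbA⟩ := exists_linearIndepOn_id_extension hu huA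
  obtain ⟨bB, hbBB, hubB, hBbB, hbB⟩ := exists_linearIndepOn_id_extension hu huB
  -- spans
  have hspanA : span ℚ bA = A :=
    le_antisymm (Submodule.span_le.2 hbAA) (fun z hz => hAbA hz)
  have hspanBd : span ℚ (bB \ bA) ≤ B :=
    Submodule.span_le.2 (sdiff_subset.trans hbBB)
  have hUle : (A ⊓ B : Submodule ℚ ℂ) ≤ span ℚ u := fun z hz => hUu hz
  -- (1') `bA ∪ bB` is linearly independent
  have hdisj_sets : Disjoint u (bB \ bA) :=
    Set.disjoint_left.2 fun z hzu hz => hz.2 (hubA hzu)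
  have hdisjU : Disjoint (span ℚ u) (span ℚ (bB \ bA)) :=
    ((linearIndepOn_id_union_iff hdisj_sets).1
      (hbB.mono (union_subset hubB sdiff_subset))).2.2
  have hdisj : Disjoint (span ℚ bA) (span ℚ (bB \ bA)) := by
    rw [Submodule.disjoint_def]
    intro z hzA hzB
    have hzU : z ∈ span ℚ u := hUle (Submodule.mem_inf.2 ⟨hspanA ▸ hzA, hspanBd hzB⟩)
    exact Submodule.disjoint_def.1 hdisjU z hzU hzB
  have hli : LinearIndepOn ℚ id (bA ∪ bB) := by
    rw [← Set.union_sdiff_self]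
    exact hbA.id_union (hbB.mono sdiff_subset) hdisj
  -- (2) Lindemann–Weierstrass on `bA ∪ bB`
  have halg : ∀ z ∈ bA ∪ bB, IsAlgebraic ℚ z := by
    rintro z (hz | hz)
    · exact hAalg z (hbAA hz)
    · exact hBalg z (hbBB hz)
  obtain ⟨hI, hinj⟩ := indep_exp_image halg hli
  -- (3) the closures of `exp '' A`, `exp '' B` are those of `exp '' bA`, `exp '' bB`
  have hA' : η ∈ M.closure (exp '' bA) := closure_exp_image_subset_of_subset_span hAbA hA
  have hB' : η ∈ M.closure (exp '' bB) := closure_exp_image_subset_of_subset_span hBbB hB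
  -- (4) intersect the two flats
  have hinter : M.closure (exp '' bA ∩ exp '' bB) = M.closure (exp '' bA) ∩ M.closure (exp '' bB) :=
    Matroid.Indep.closure_inter_eq_inter_closure (by rwa [← Set.image_union])
  have hmem : η ∈ M.closure (exp '' (bA ∩ bB)) := by
    rw [hinj.image_inter subset_union_left subset_union_right, hinter]
    exact ⟨hA', hB'⟩
  refine M.closure_subset_closure (Set.image_mono ?_) hmem
  rintro z ⟨hzA, hzB⟩
  exact Submodule.mem_inf.2 ⟨hbAA hzA, hbBB hzB⟩

end SubspaceIntersect

/-- **Registered stub `stub_exceptionalSubspacesIntersect` of line `sector-split` (v6)** —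
signature verbatim; it is LITERALLY the support item stmt-Schanuel-9553
`ExceptionalSubspaces.ExceptionalSubspacesIntersect` of route ExceptionalSubspaces: the
exceptional subspaces of any complex number are closed under intersection. [folklore] -/
theorem stub_exceptionalSubspacesIntersect :
    ∀ (η : ℂ) (A B : Submodule ℚ ℂ), (∀ z ∈ A, IsAlgebraic ℚ z) → (∀ z ∈ B, IsAlgebraic ℚ z) →
      IsAlgebraic ↥(IntermediateField.adjoin ℚ (Complex.exp '' (A : Set ℂ))) η →
      IsAlgebraic ↥(IntermediateField.adjoin ℚ (Complex.exp '' (B : Set ℂ))) η →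
      IsAlgebraic ↥(IntermediateField.adjoin ℚ (Complex.exp '' ((A ⊓ B : Submodule ℚ ℂ) : Set ℂ))) η :=
  SubspaceIntersect.engine

/-- The support item stmt-Schanuel-9553 of route ExceptionalSubspaces holds:
`ExceptionalSubspaces.ExceptionalSubspacesIntersect`. [folklore] -/
theorem SubspaceIntersect.exceptionalSubspacesIntersect :
    ExceptionalSubspaces.ExceptionalSubspacesIntersect :=
  stub_exceptionalSubspacesIntersect

end Summit.Schanuel.Schanuel.Theorems.RigidCore

end
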